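import Literature.Barriers.CriticalPhenomena.SubexponentialGrowthZdNarrow
import Literature.Probability.Percolation.SusceptibilityMeanFieldLower
import Literature.Probability.Percolation.CriticalContinuity
import HarnessLib

/-!
# The budget of `TwoArmWindow`: a volume window forces `Δ₀ ≥ 1`, and `Δ₀ < 2` is summit-strength

Crux `Summit.CriticalPhenomena.PercolationContinuityZ3.Theses.PercMinContact.TwoArmWindow`
(item stmt-CriticalPhenomena-11499), line `registered` (`Cruxes/TwoArmWindow/Lines/birth.lean`, rev 4),
lead prover-line-stmt-CriticalPhenomena-11499-c3-0, `--supports stmt-CriticalPhenomena-11499`.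

Engine (b) of the crux is a SUBCRITICAL VOLUME WINDOW with gap exponent `Δ₀`: near `p_c(ℤ³)`,
`P_u(|C(0)| ≥ n) ≤ C · exp(−c · n · (p_c − u)^{Δ₀})`.  The line allocates `Δ₀ < 5/2` to it (and
`λ ≥ 3/5` to the two-arm engine (a), budget `Δ₀(1 − λ) < 1`).  This file makes the two standing
remarks about that allocation KERNEL-CHECKED, for every such window (only levels near `p_c` are used,
so the hypothesis is the NEAR window of the registered stub `stub_gapWindowNear`, without `Δ₀ < 5/2`):

* `twoArmWindow_gap_ge_one` — **any volume window has `Δ₀ ≥ 1`**: summing the window over `n`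
  (layer cake, `expClusterSize_le_tsum_measure_clusterSizeGe`, and a geometric series,
  `expClusterSize_le_of_volumeWindow`) gives `χ(u) = E_u|C(0)| ≤ C/(c (p_c − u)^{Δ₀})`, while the
  Aizenman–Newman mean-field bound (`AizenmanNewman1984_chi_lower_holds`, PROVED: `χ(u) ≥ 1/(6(p_c−u))`)
  forbids `Δ₀ < 1`.  So the corner `λ = 0` of the crux (`Δ₀ < 1`) is empty, as the refuters said.
* `percolationContinuityZ3_of_gapWindow_lt_two` — **a window with `Δ₀ < 2` already proves the
  summit** `θ(p_c) = 0` on `ℤ³`: `(p_c − u)² χ(u) ≤ (C/c)(p_c − u)^{2−Δ₀} → 0`, and the in-tree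
  Hutchcroft–Newman criterion `percolationContinuity_of_sq_mul_expClusterSize` (Hutchcroft 2022
  Thm 1.3 + Markov, PROVED) concludes.  Hence the free allocation `λ = 1/2` (two-ghost, KNOWN), which
  would need `Δ₀ < 2`, is summit-strength ("costume"), and the registered allocation keeps `Δ₀ ∈ [2, 5/2)`
  — where the true gap exponent `Δ = 1/σ ≈ 2.21` lives — as the informative cell.

Everything used is proved in the tree; axioms are Mathlib's.
-/

noncomputable section

namespace Summit.CriticalPhenomena.PercolationContinuityZ3.Theorems

open MeasureTheory Filter Literature.Probability.Percolation Literature.Probability.LatticeModels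
open scoped ENNReal Topology

namespace TwoArmWindowBudget

/-! ## §1 Layer cake: `E|C| ≤ Σ_{k ≥ 0} P(|C| ≥ k+1)` -/

/-- Counting in `ℝ≥0∞`: `m ≤ Σ_{k ≥ 0} 𝟙{k+1 ≤ m}` for `m ∈ ℕ∞` (equality in fact; for `m = ⊤` the
right side is an infinite sum of ones). [folklore] -/
theorem toENNReal_le_tsum_indicator (m : ℕ∞) :
    (m : ℝ≥0∞) ≤ ∑' k : ℕ, (if ((k + 1 : ℕ) : ℕ∞) ≤ m then (1 : ℝ≥0∞) else 0) := by
  induction m using ENat.recTopCoe with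
  | top =>
    have : (fun k : ℕ => (if ((k + 1 : ℕ) : ℕ∞) ≤ (⊤ : ℕ∞) then (1 : ℝ≥0∞) else 0)) =
        fun _ => 1 := by
      funext k; rw [if_pos le_top]
    rw [this, ENNReal.tsum_const_eq_top_of_ne_zero one_ne_zero]
    exact le_top
  | coe m =>
    calc ((m : ℕ∞) : ℝ≥0∞) = ∑ _k ∈ Finset.range m, (1 : ℝ≥0∞) := by simp
      _ = ∑ k ∈ Finset.range m, (if ((k + 1 : ℕ) : ℕ∞) ≤ (m : ℕ∞) then (1 : ℝ≥0∞) else 0) := by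
          refine Finset.sum_congr rfl fun k hk => ?_
          rw [if_pos (by exact_mod_cast Finset.mem_range.1 hk)]
      _ ≤ ∑' k : ℕ, (if ((k + 1 : ℕ) : ℕ∞) ≤ (m : ℕ∞) then (1 : ℝ≥0∞) else 0) :=
          ENNReal.sum_le_tsum _

/-- **Layer cake (upper half)**: `E_p|C(x)| ≤ Σ_{k ≥ 0} P_p(|C(x)| ≥ k+1)` on any countable graph
(Tonelli for the indicators of the measurable events `{|C(x)| ≥ k+1}`). [folklore] -/
theorem expClusterSize_le_tsum_measure_clusterSizeGe {V : Type*} [Countable V] (G : SimpleGraph V)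
    (x : V) (p : unitInterval) :
    expClusterSize G x p ≤ ∑' k : ℕ, (bondPercolation G p) (clusterSizeGe x (k + 1)) := by
  classical
  set μ := bondPercolation G p with hμ
  have hind : ∀ k : ℕ, ∀ ω : BondConfig V,
      (clusterSizeGe x (k + 1)).indicator (1 : BondConfig V → ℝ≥0∞) ω =
        if (((k + 1 : ℕ)) : ℕ∞) ≤ (openCluster ω x).encard then 1 else 0 := by
    intro k ω
    by_cases h : (((k + 1 : ℕ)) : ℕ∞) ≤ (openCluster ω x).encard
    · rw [if_pos h, Set.indicator_of_mem (show ω ∈ clusterSizeGe x (k + 1) from h)]; rfl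
    · rw [if_neg h, Set.indicator_of_notMem (show ω ∉ clusterSizeGe x (k + 1) from h)]
  calc expClusterSize G x p
      ≤ ∫⁻ ω, ∑' k : ℕ, (clusterSizeGe x (k + 1)).indicator (1 : BondConfig V → ℝ≥0∞) ω ∂μ := by
        refine lintegral_mono fun ω => ?_
        simp_rw [hind]
        exact toENNReal_le_tsum_indicator _
    _ = ∑' k : ℕ, ∫⁻ ω, (clusterSizeGe x (k + 1)).indicator (1 : BondConfig V → ℝ≥0∞) ω ∂μ :=
        lintegral_tsum fun k =>
          (measurable_one.indicator (measurableSet_clusterSizeGe x (k + 1))).aemeasurable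
    _ = ∑' k : ℕ, μ (clusterSizeGe x (k + 1)) :=
        tsum_congr fun k => lintegral_indicator_one (measurableSet_clusterSizeGe x (k + 1))

/-! ## §2 Summing a window: `E_u|C(0)| ≤ C/(c t)` if `P_u(|C(0)| ≥ n) ≤ C e^{−c n t}` -/

/-- The geometric series behind the window: for `c, t > 0`,
`Σ_{k ≥ 0} e^{−c (k+1) t} = 1/(e^{ct} − 1) ≤ 1/(c t)` (`e^x − 1 ≥ x`). [folklore] -/
theorem tsum_exp_neg_mul_succ_le {c t : ℝ} (hc : 0 < c) (ht : 0 < t) :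
    Summable (fun k : ℕ => Real.exp (-(c * ((k + 1 : ℕ) : ℝ) * t))) ∧
      ∑' k : ℕ, Real.exp (-(c * ((k + 1 : ℕ) : ℝ) * t)) ≤ 1 / (c * t) := by
  set r : ℝ := Real.exp (-(c * t)) with hr
  have hr0 : 0 ≤ r := (Real.exp_pos _).le
  have hr1 : r < 1 := Real.exp_lt_one_iff.2 (by nlinarith)
  have hterm : ∀ k : ℕ, Real.exp (-(c * ((k + 1 : ℕ) : ℝ) * t)) = r * r ^ k := by
    intro k
    rw [hr, ← Real.exp_nat_mul, ← Real.exp_add]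
    congr 1
    push_cast
    ring
  have hs : Summable fun k : ℕ => r * r ^ k :=
    (summable_geometric_of_lt_one hr0 hr1).mul_left r
  refine ⟨(summable_congr hterm).2 hs, ?_⟩
  rw [tsum_congr hterm, tsum_mul_left, tsum_geometric_of_lt_one hr0 hr1]
  -- `r/(1-r) = 1/(e^{ct} - 1) ≤ 1/(ct)`
  have hct : 0 < c * t := mul_pos hc ht
  have hexp : c * t + 1 ≤ Real.exp (c * t) := Real.add_one_le_exp _
  have h1r : 0 < 1 - r := by linarith
  have hrexp : r * Real.exp (c * t) = 1 := by rw [hr, ← Real.exp_add]; simp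
  rw [div_eq_mul_inv, one_mul, ← div_eq_mul_inv, div_le_iff₀ h1r,
    ← mul_le_mul_iff_of_pos_left (Real.exp_pos (c * t))]
  -- goal: `exp(ct) * r ≤ exp(ct) * ((ct)⁻¹ * (1 - r))`
  have : Real.exp (c * t) * ((c * t)⁻¹ * (1 - r)) = (Real.exp (c * t) - 1) * (c * t)⁻¹ := by
    have : Real.exp (c * t) * r = 1 := by rw [mul_comm]; exact hrexp
    field_simp
    nlinarith [this]
  rw [this, mul_comm (Real.exp (c * t)) r, hrexp]
  rw [le_mul_inv_iff₀ hct]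
  linarith

/-- **Summing a volume window.**  If at a level `u` one has `P_u(|C(0)| ≥ n) ≤ C · e^{−c n t}` for all
`n` (`c, t > 0`), then `E_u|C(0)| ≤ C/(c t)` (layer cake + geometric series; `C ≥ 0` is forced by
`n = 0`). [folklore] -/
theorem expClusterSize_le_of_volumeWindow {V : Type*} [Countable V] (G : SimpleGraph V) (x : V)
    (u : unitInterval) {C c t : ℝ} (hc : 0 < c) (ht : 0 < t)
    (hwin : ∀ n : ℕ, (bondPercolation G u).real (clusterSizeGe x n) ≤
      C * Real.exp (-(c * n * t))) :
    expClusterSize G x u ≤ ENNReal.ofReal (C / (c * t)) := by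
  set μ := bondPercolation G u with hμ
  have hC : 0 ≤ C := by
    have h := hwin 0
    rw [clusterSizeGe_zero, probReal_univ] at h
    exact zero_le_one.trans (by simpa using h)
  obtain ⟨hs, hle⟩ := tsum_exp_neg_mul_succ_le hc ht
  have hs' : Summable fun k : ℕ => C * Real.exp (-(c * ((k + 1 : ℕ) : ℝ) * t)) := hs.mul_left C
  calc expClusterSize G x u ≤ ∑' k : ℕ, μ (clusterSizeGe x (k + 1)) :=
        expClusterSize_le_tsum_measure_clusterSizeGe G x u
    _ = ∑' k : ℕ, ENNReal.ofReal (μ.real (clusterSizeGe x (k + 1))) :=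
        tsum_congr fun k => (ofReal_measureReal (measure_ne_top _ _)).symm
    _ ≤ ∑' k : ℕ, ENNReal.ofReal (C * Real.exp (-(c * ((k + 1 : ℕ) : ℝ) * t))) :=
        ENNReal.tsum_le_tsum fun k => ENNReal.ofReal_le_ofReal (hwin (k + 1))
    _ = ENNReal.ofReal (∑' k : ℕ, C * Real.exp (-(c * ((k + 1 : ℕ) : ℝ) * t))) :=
        (ENNReal.ofReal_tsum_of_nonneg
          (fun k => mul_nonneg hC (Real.exp_pos _).le) hs').symm
    _ ≤ ENNReal.ofReal (C / (c * t)) := by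
        refine ENNReal.ofReal_le_ofReal ?_
        rw [tsum_mul_left, div_eq_mul_one_div]
        exact mul_le_mul_of_nonneg_left hle hC

/-! ## §3 The levels `u = p_c − s` -/

/-- The level `p_c(ℤ³) − s` as a point of `[0,1]`, for `0 < s < p_c` (`p_c < 1`,
`Grimmett1999_criticalProb_pos_lt_one_holds`). [folklore] -/
theorem exists_level_sub (s : ℝ) (hs0 : 0 < s) (hs1 : s < criticalProb (zdGraph 3) (0 : Site 3)) :
    ∃ u : unitInterval, (u : ℝ) = criticalProb (zdGraph 3) (0 : Site 3) - s := by
  have hpc := Grimmett1999_criticalProb_pos_lt_one_holds 3 (by norm_num)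
  exact ⟨⟨criticalProb (zdGraph 3) (0 : Site 3) - s, by linarith, by linarith [hpc.2]⟩, rfl⟩

/-- **`χ(p_c − s) ≤ C/(c s^{Δ₀})` from a near-critical volume window** at the level `u = p_c − s`,
`0 < s < ε₀`, `s < p_c`. [folklore] -/
theorem chi_le_of_gapWindowNear {Δ₀ C c ε₀ : ℝ} (hc : 0 < c)
    (hwin : ∀ u : unitInterval, criticalProb (zdGraph 3) 0 - ε₀ < (u : ℝ) →
      (u : ℝ) < criticalProb (zdGraph 3) 0 → ∀ n : ℕ,
        (bondPercolation (zdGraph 3) u).real {ω | (n : ℕ∞) ≤ (openCluster ω 0).encard} ≤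
          C * Real.exp (-(c * n * (criticalProb (zdGraph 3) 0 - u) ^ Δ₀)))
    (u : unitInterval) (hu₁ : criticalProb (zdGraph 3) 0 - ε₀ < (u : ℝ))
    (hu₂ : (u : ℝ) < criticalProb (zdGraph 3) 0) :
    expClusterSize (zdGraph 3) (0 : Site 3) u ≤
        ENNReal.ofReal (C / (c * (criticalProb (zdGraph 3) 0 - u) ^ Δ₀)) ∧
      chi 3 u ≤ C / (c * (criticalProb (zdGraph 3) 0 - u) ^ Δ₀) := by
  have hs : 0 < criticalProb (zdGraph 3) 0 - (u : ℝ) := sub_pos.2 hu₂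
  have ht : 0 < (criticalProb (zdGraph 3) 0 - (u : ℝ)) ^ Δ₀ := Real.rpow_pos_of_pos hs _
  have hE := expClusterSize_le_of_volumeWindow (zdGraph 3) (0 : Site 3) u hc ht
    (fun n => hwin u hu₁ hu₂ n)
  refine ⟨hE, ?_⟩
  have hC : 0 ≤ C := by
    have h := hwin u hu₁ hu₂ 0
    have h1 : (bondPercolation (zdGraph 3) u).real {ω | ((0 : ℕ) : ℕ∞) ≤ (openCluster ω 0).encard} = 1 := by
      rw [show {ω : BondConfig (Site 3) | ((0 : ℕ) : ℕ∞) ≤ (openCluster ω 0).encard} = Set.univ from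
        Set.eq_univ_of_forall fun ω => by simp, probReal_univ]
    rw [h1] at h
    exact zero_le_one.trans (by simpa using h)
  rw [expClusterSize_eq_ofReal_chi (d := 3) (by norm_num) u hu₂] at hE
  exact (ENNReal.ofReal_le_ofReal_iff (div_nonneg hC (mul_pos hc ht).le)).1 hE

end TwoArmWindowBudget

open TwoArmWindowBudget

/-- **Any near-critical volume window on `ℤ³` has gap exponent `Δ₀ ≥ 1`.**  If for some `ε₀ > 0`,
`c > 0`, `C` and `Δ₀ > 0` one has `P_u(|C(0)| ≥ n) ≤ C · exp(−c · n · (p_c − u)^{Δ₀})` for all levels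
`p_c − ε₀ < u < p_c` and all `n`, then `1 ≤ Δ₀`: the window sums to `χ(u) ≤ C/(c (p_c−u)^{Δ₀})`
(`chi_le_of_gapWindowNear`) while `χ(u) ≥ 1/(6 (p_c − u))` (Aizenman–Newman,
`AizenmanNewman1984_chi_lower_holds`), which is impossible as `u ↑ p_c` if `Δ₀ < 1`.  In particular
every witness `(λ, Δ₀, C, c)` of the crux `TwoArmWindow` has `Δ₀ ≥ 1`, hence `λ > 0`. [folklore] -/
theorem twoArmWindow_gap_ge_one :
    ∀ Δ₀ C c ε₀ : ℝ, 0 < Δ₀ → 0 < c → 0 < ε₀ →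
      (∀ u : unitInterval, criticalProb (zdGraph 3) 0 - ε₀ < (u : ℝ) →
        (u : ℝ) < criticalProb (zdGraph 3) 0 → ∀ n : ℕ,
          (bondPercolation (zdGraph 3) u).real {ω | (n : ℕ∞) ≤ (openCluster ω 0).encard} ≤
            C * Real.exp (-(c * n * (criticalProb (zdGraph 3) 0 - u) ^ Δ₀))) →
      1 ≤ Δ₀ := by
  intro Δ₀ C c ε₀ hΔ₀ hc hε₀ hwin
  by_contra hlt
  rw [not_le] at hlt
  have hpc := Grimmett1999_criticalProb_pos_lt_one_holds 3 (by norm_num)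
  set pc : ℝ := criticalProb (zdGraph 3) (0 : Site 3) with hpc_def
  -- at the level `u = pc - s` (`0 < s < min ε₀ pc`): `1/(6 s) ≤ χ ≤ C/(c s^{Δ₀})`, i.e. `c ≤ 6 C s^{1-Δ₀}`
  have key : ∀ s : ℝ, 0 < s → s < ε₀ → s < pc → c ≤ 6 * C * s ^ (1 - Δ₀) := by
    intro s hs0 hsε hspc
    obtain ⟨u, hu⟩ := exists_level_sub s hs0 hspc
    have hu₁ : pc - ε₀ < (u : ℝ) := by rw [hu]; linarith
    have hu₂ : (u : ℝ) < pc := by rw [hu]; linarith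
    have hchi := (chi_le_of_gapWindowNear hc hwin u hu₁ hu₂).2
    have hAN := AizenmanNewman1984_chi_lower_holds 3 (by norm_num) u hu₂
    rw [hu, show pc - (pc - s) = s by ring] at hchi hAN
    have hsΔ : 0 < s ^ Δ₀ := Real.rpow_pos_of_pos hs0 _
    -- `1/(6 s) ≤ C/(c s^Δ₀)`  ⇒  `c s^Δ₀ ≤ 6 C s`
    have h1 : 1 / (2 * (3 : ℕ) * s) ≤ C / (c * s ^ Δ₀) := hAN.trans hchi
    have h2 : c * s ^ Δ₀ ≤ 6 * C * s := by
      rw [div_le_div_iff₀ (by positivity) (mul_pos hc hsΔ)] at h1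
      push_cast at h1
      linarith
    -- divide by `s^Δ₀`: `s / s^Δ₀ = s^{1-Δ₀}`
    have h3 : s ^ (1 - Δ₀) = s / s ^ Δ₀ := by
      rw [Real.rpow_sub hs0, Real.rpow_one]
    rw [h3, mul_div_assoc', le_div_iff₀ hsΔ]
    linarith
  -- choose `s` with `6 C s^{1-Δ₀} < c`
  have h1Δ : 0 < 1 - Δ₀ := by linarith
  rcases le_or_gt C 0 with hC | hC
  · -- `C ≤ 0`: any admissible `s` contradicts `c > 0`
    set s : ℝ := min (ε₀ / 2) (pc / 2) with hs_def
    have hs0 : 0 < s := lt_min (by linarith) (by linarith [hpc.1])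
    have h := key s hs0 (lt_of_le_of_lt (min_le_left _ _) (by linarith))
      (lt_of_le_of_lt (min_le_right _ _) (by linarith [hpc.1]))
    have : 6 * C * s ^ (1 - Δ₀) ≤ 0 :=
      mul_nonpos_of_nonpos_of_nonneg (by linarith) (Real.rpow_nonneg hs0.le _)
    linarith
  · -- `C > 0`: take `s ≤ s₀ := (c/(12 C))^{1/(1-Δ₀)}`, so that `6 C s^{1-Δ₀} ≤ c/2`
    set s₀ : ℝ := (c / (12 * C)) ^ (1 - Δ₀)⁻¹ with hs₀_def
    have hq0 : 0 < c / (12 * C) := by positivity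
    have hs₀0 : 0 < s₀ := Real.rpow_pos_of_pos hq0 _
    set s : ℝ := min s₀ (min (ε₀ / 2) (pc / 2)) with hs_def
    have hs0 : 0 < s := lt_min hs₀0 (lt_min (by linarith) (by linarith [hpc.1]))
    have hsε : s < ε₀ := lt_of_le_of_lt ((min_le_right _ _).trans (min_le_left _ _)) (by linarith)
    have hspc : s < pc :=
      lt_of_le_of_lt ((min_le_right _ _).trans (min_le_right _ _)) (by linarith [hpc.1])
    have h := key s hs0 hsε hspc
    have hpow : s ^ (1 - Δ₀) ≤ c / (12 * C) := by
      calc s ^ (1 - Δ₀) ≤ s₀ ^ (1 - Δ₀) := Real.rpow_le_rpow hs0.le (min_le_left _ _) h1Δ.le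
        _ = c / (12 * C) := by rw [hs₀_def, Real.rpow_inv_rpow hq0.le h1Δ.ne']
    have : 6 * C * s ^ (1 - Δ₀) ≤ 6 * C * (c / (12 * C)) :=
      mul_le_mul_of_nonneg_left hpow (by positivity)
    have h12 : 6 * C * (c / (12 * C)) = c / 2 := by field_simp; ring
    linarith

/-- **A volume window with `Δ₀ < 2` is summit-strength: it proves `θ(p_c) = 0` on `ℤ³`.**  If for
some `ε₀ > 0`, `c > 0`, `C` and `0 < Δ₀ < 2` one has `P_u(|C(0)| ≥ n) ≤ C · exp(−c · n · (p_c − u)^{Δ₀})`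
for all levels `p_c − ε₀ < u < p_c` and all `n`, then `PercolationContinuityZ3`: the window sums to
`E_u|C(0)| ≤ C/(c (p_c − u)^{Δ₀})` (`chi_le_of_gapWindowNear`), so `(p_c − u)² E_u|C(0)| ≤ (C/c)(p_c−u)^{2−Δ₀}`
is as small as desired near `p_c`, and the Hutchcroft–Newman criterion
`percolationContinuity_of_sq_mul_expClusterSize` (Hutchcroft 2022 Thm 1.3 + Markov, PROVED in the
tree) gives `θ(p_c) = 0`.  This is why the line keeps `Δ₀ ≥ 2` as the informative cell: with the
KNOWN two-arm exponent `λ = 1/2` the budget `Δ₀(1−λ) < 1` would ask for exactly such a window.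
[cite: Hutchcroft2022Triangle, Thm. 1.3 and the paragraph following it] -/
theorem percolationContinuityZ3_of_gapWindow_lt_two :
    ∀ Δ₀ C c ε₀ : ℝ, 0 < Δ₀ → Δ₀ < 2 → 0 < c → 0 < ε₀ →
      (∀ u : unitInterval, criticalProb (zdGraph 3) 0 - ε₀ < (u : ℝ) →
        (u : ℝ) < criticalProb (zdGraph 3) 0 → ∀ n : ℕ,
          (bondPercolation (zdGraph 3) u).real {ω | (n : ℕ∞) ≤ (openCluster ω 0).encard} ≤
            C * Real.exp (-(c * n * (criticalProb (zdGraph 3) 0 - u) ^ Δ₀))) →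
      PercolationContinuityZ3 := by
  intro Δ₀ C c ε₀ hΔ₀ hΔ2 hc hε₀ hwin
  have hpc := Grimmett1999_criticalProb_pos_lt_one_holds 3 (by norm_num)
  set pc : ℝ := criticalProb (zdGraph 3) (0 : Site 3) with hpc_def
  show PercolationContinuity 3
  refine Literature.Barriers.CriticalPhenomena.percolationContinuity_of_sq_mul_expClusterSize
    (d := 3) (by norm_num) fun η hη δ hδ => ?_
  -- `C ≥ 0` from the window at `n = 0` (at any admissible level)
  have h2Δ : 0 < 2 - Δ₀ := by linarith
  -- the admissible scale: `s < min ε₀ δ pc`, and (if `C > 0`) `s^{2-Δ₀} ≤ η c/(2C)`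
  obtain ⟨s, hs0, hsε, hsδ, hspc, hsmall⟩ : ∃ s : ℝ, 0 < s ∧ s < ε₀ ∧ s < δ ∧ s < pc ∧
      C * s ^ (2 - Δ₀) ≤ η * c / 2 := by
    rcases le_or_gt C 0 with hC | hC
    · refine ⟨min (ε₀ / 2) (min (δ / 2) (pc / 2)), lt_min (by linarith) (lt_min (by linarith)
        (by linarith [hpc.1])), ?_, ?_, ?_, ?_⟩
      · exact lt_of_le_of_lt (min_le_left _ _) (by linarith)
      · exact lt_of_le_of_lt ((min_le_right _ _).trans (min_le_left _ _)) (by linarith)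
      · exact lt_of_le_of_lt ((min_le_right _ _).trans (min_le_right _ _)) (by linarith [hpc.1])
      · have : C * (min (ε₀ / 2) (min (δ / 2) (pc / 2))) ^ (2 - Δ₀) ≤ 0 :=
          mul_nonpos_of_nonpos_of_nonneg hC (Real.rpow_nonneg (le_min (by linarith)
            (le_min (by linarith) (by linarith [hpc.1]))) _)
        have : 0 ≤ η * c / 2 := by positivity
        linarith
    · set s₀ : ℝ := (η * c / (2 * C)) ^ (2 - Δ₀)⁻¹ with hs₀_def
      have hq0 : 0 < η * c / (2 * C) := by positivity
      have hs₀0 : 0 < s₀ := Real.rpow_pos_of_pos hq0 _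
      refine ⟨min s₀ (min (ε₀ / 2) (min (δ / 2) (pc / 2))), lt_min hs₀0 (lt_min (by linarith)
        (lt_min (by linarith) (by linarith [hpc.1]))), ?_, ?_, ?_, ?_⟩
      · exact lt_of_le_of_lt ((min_le_right _ _).trans (min_le_left _ _)) (by linarith)
      · exact lt_of_le_of_lt ((min_le_right _ _).trans ((min_le_right _ _).trans (min_le_left _ _)))
          (by linarith)
      · exact lt_of_le_of_lt ((min_le_right _ _).trans ((min_le_right _ _).trans (min_le_right _ _)))
          (by linarith [hpc.1])
      · have hmin0 : 0 ≤ min s₀ (min (ε₀ / 2) (min (δ / 2) (pc / 2))) :=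
          le_min hs₀0.le (le_min (by linarith) (le_min (by linarith) (by linarith [hpc.1])))
        have hpow : (min s₀ (min (ε₀ / 2) (min (δ / 2) (pc / 2)))) ^ (2 - Δ₀) ≤ η * c / (2 * C) := by
          calc _ ≤ s₀ ^ (2 - Δ₀) := Real.rpow_le_rpow hmin0 (min_le_left _ _) h2Δ.le
            _ = η * c / (2 * C) := by rw [hs₀_def, Real.rpow_inv_rpow hq0.le h2Δ.ne']
        calc C * (min s₀ (min (ε₀ / 2) (min (δ / 2) (pc / 2)))) ^ (2 - Δ₀)
            ≤ C * (η * c / (2 * C)) := mul_le_mul_of_nonneg_left hpow hC.le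
          _ = η * c / 2 := by field_simp
  -- the level `u = pc - s`
  obtain ⟨u, hu⟩ := exists_level_sub s hs0 hspc
  have hu₁ : pc - ε₀ < (u : ℝ) := by rw [hu]; linarith
  have hu₂ : (u : ℝ) < pc := by rw [hu]; linarith
  refine ⟨u, by rw [hu]; linarith, hu₂, ?_⟩
  have hE := (chi_le_of_gapWindowNear hc hwin u hu₁ hu₂).1
  rw [hu, show pc - (pc - s) = s by ring] at hE ⊢
  refine hE.trans (ENNReal.ofReal_le_ofReal ?_)
  -- `C/(c s^Δ₀) ≤ η/s²` ⟸ `C s² ≤ η c s^Δ₀` ⟸ `C s^{2-Δ₀} ≤ η c/2`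
  have hsΔ : 0 < s ^ Δ₀ := Real.rpow_pos_of_pos hs0 _
  rw [div_le_div_iff₀ (mul_pos hc hsΔ) (by positivity)]
  have hsplit : s ^ (2 : ℕ) = s ^ (2 - Δ₀) * s ^ Δ₀ := by
    rw [← Real.rpow_natCast s 2, ← Real.rpow_add hs0]
    norm_num
  calc C * s ^ 2 = C * s ^ (2 - Δ₀) * s ^ Δ₀ := by rw [hsplit, mul_assoc]
    _ ≤ η * c / 2 * s ^ Δ₀ := mul_le_mul_of_nonneg_right hsmall hsΔ.le
    _ ≤ η * (c * s ^ Δ₀) := by nlinarith [mul_pos (mul_pos hη hc) hsΔ]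

end Summit.CriticalPhenomena.PercolationContinuityZ3.Theorems

end
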